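import Mathlib
import HarnessLib

/-!
# Route `UnthreadedDoor`, crux `PoloidalLiouville` (stmt-NavierStokesRegularity-1222), WALL W1 — crux idea «null-time» tooling:
# the NULL-TIME BARRIER (a `C¹` monotone function of arbitrarily small size with slope `N` near a closed null set)

For a closed Lebesgue-null set `D ⊆ ℝ` and constants `N, κ > 0` there is `G : ℝ → ℝ` of class `C¹` with `G' = N ψ`,
`ψ` continuous, `0 ≤ ψ`, `G` nondecreasing, `0 ≤ G ≤ κ` on `[s₁, ∞)` (and `G ≤ κ` everywhere), and `G d − G σ = N (d − σ)` for
`σ` slightly to the left of any `d ∈ D` (`exists_nullTimeBarrier`).  Construction: an open `O ⊇ D` of measure `< κ/N` (outer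
regularity — the only use of «null»), an open `V` with `D ⊆ V ⊆ closure V ⊆ O` (normality — the only use of «closed»), a Urysohn
function `ψ` (`= 1` on `closure V`, `= 0` off `O`, values in `[0,1]`), and `G σ = N ∫_{s₁}^{σ} ψ`.

USE (ARM A g5, «null-time» AE-2′): added to the strict supersolution of the half-line OU comparison
(`HalfLineOU.halfLineOU_decay_viscosity`), it keeps strictness (`G' ≥ 0`), moves the bound by at most `κ`, and forces the
interior maximiser of `U − Ψ − G` OFF `D` when `U` is Lipschitz in time (slope `N` > Lipschitz slack) — so a viscosity
inequality known only at touching times outside a closed null set suffices.  Pure real analysis; no NS statement; 1222 / W1 /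
NS regularity OPEN.  `--supports stmt-NavierStokesRegularity-1222 --as helper`.  [folklore]
-/

noncomputable section

-- the summit and its single sub-problem share the name (CONVENTIONS §1)
set_option linter.dupNamespace false

open Set Function Filter Topology MeasureTheory Metric

namespace Summit.NavierStokesRegularity.NavierStokesRegularity.Theorems.PoloidalLiouville.NetFlux

/-- **The null-time barrier.**  `D` closed with `volume D = 0`, `N, κ > 0`, base time `s₁`.  There are `G ψ : ℝ → ℝ` with:
`ψ` continuous and nonnegative; `HasDerivAt G (N * ψ σ) σ` for every `σ`; `G` nondecreasing; `0 ≤ G σ` for `σ ≥ s₁`;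
`G σ ≤ κ` for every `σ`; and every `d ∈ D` has an `r > 0` with `G d − G σ = N (d − σ)` for `σ ∈ [d − r, d]`. [folklore] -/
theorem exists_nullTimeBarrier {D : Set ℝ} (hD : IsClosed D) (hD0 : volume D = 0) (s₁ : ℝ) {N κ : ℝ}
    (hN : 0 < N) (hκ : 0 < κ) :
    ∃ G ψ : ℝ → ℝ, Continuous ψ ∧ (∀ σ, 0 ≤ ψ σ) ∧ (∀ σ, HasDerivAt G (N * ψ σ) σ) ∧
      (∀ σ τ, τ ≤ σ → G τ ≤ G σ) ∧ (∀ σ, s₁ ≤ σ → 0 ≤ G σ) ∧ (∀ σ, G σ ≤ κ) ∧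
      (∀ d ∈ D, ∃ r > 0, ∀ σ ∈ Icc (d - r) d, G d - G σ = N * (d - σ)) := by
  -- an open set of small measure around `D`
  have hκN : 0 < κ / N := div_pos hκ hN
  obtain ⟨O, hDO, hO, hOvol⟩ := Set.exists_isOpen_lt_of_lt D (ENNReal.ofReal (κ / N))
    (by rw [hD0]; exact ENNReal.ofReal_pos.2 hκN)
  have hOfin : volume O < ⊤ := hOvol.trans ENNReal.ofReal_lt_top
  have hOle : (volume O).toReal ≤ κ / N := ENNReal.toReal_le_of_le_ofReal hκN.le hOvol.le
  -- an intermediate neighbourhood and a Urysohn function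
  obtain ⟨V, hV, hDV, hVO⟩ := normal_exists_closure_subset hD hO hDO
  obtain ⟨f, hf0, hf1, hf01⟩ := exists_continuous_zero_one_of_isClosed hO.isClosed_compl isClosed_closure
    (disjoint_compl_left_iff.2 hVO)
  have hfc : Continuous f := f.continuous
  have hfnn : ∀ t, 0 ≤ f t := fun t => (hf01 t).1
  have hfle : ∀ t, f t ≤ O.indicator (fun _ => (1 : ℝ)) t := by
    intro t
    by_cases ht : t ∈ O
    · rw [indicator_of_mem ht]; exact (hf01 t).2
    · rw [indicator_of_notMem ht]; exact le_of_eq (hf0 ht)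
  have hint : ∀ a b : ℝ, IntervalIntegrable f volume a b := fun a b => hfc.intervalIntegrable a b
  -- the barrier
  refine ⟨fun σ => N * ∫ t in s₁..σ, f t, f, hfc, hfnn, fun σ => ?_, fun σ τ hτσ => ?_, fun σ hσ => ?_,
    fun σ => ?_, fun d hd => ?_⟩
  · -- derivative
    exact (hfc.integral_hasStrictDerivAt s₁ σ).hasDerivAt.const_mul N
  · -- monotone
    have h1 : (∫ t in s₁..σ, f t) - ∫ t in s₁..τ, f t = ∫ t in τ..σ, f t :=
      intervalIntegral.integral_interval_sub_left (hint _ _) (hint _ _)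
    have h2 : 0 ≤ ∫ t in τ..σ, f t := intervalIntegral.integral_nonneg hτσ fun t _ => hfnn t
    nlinarith [h1, h2, hN]
  · -- nonnegative after `s₁`
    exact mul_nonneg hN.le (intervalIntegral.integral_nonneg hσ fun t _ => hfnn t)
  · -- small: `G σ ≤ N · volume O ≤ κ`
    have hIO : Integrable (O.indicator fun _ => (1 : ℝ)) volume :=
      (integrable_indicator_iff hO.measurableSet).2 (integrableOn_const hOfin.ne)
    have hbound : ∀ a b : ℝ, a ≤ b → ∫ t in a..b, f t ≤ κ / N := by
      intro a b hab
      rw [intervalIntegral.integral_of_le hab]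
      calc ∫ t in Ioc a b, f t ≤ ∫ t in Ioc a b, O.indicator (fun _ => (1 : ℝ)) t :=
            setIntegral_mono_on (hfc.integrableOn_Icc.mono_set Ioc_subset_Icc_self) hIO.integrableOn
              measurableSet_Ioc fun t _ => hfle t
        _ ≤ ∫ t, O.indicator (fun _ => (1 : ℝ)) t :=
            setIntegral_le_integral hIO (Eventually.of_forall fun t => indicator_nonneg (fun _ _ => zero_le_one) t)
        _ = (volume O).toReal := integral_indicator_one hO.measurableSet
        _ ≤ κ / N := hOle
    show N * ∫ t in s₁..σ, f t ≤ κ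
    rcases le_total s₁ σ with h | h
    · calc N * ∫ t in s₁..σ, f t ≤ N * (κ / N) := mul_le_mul_of_nonneg_left (hbound s₁ σ h) hN.le
        _ = κ := by field_simp
    · have h1 : ∫ t in s₁..σ, f t = -∫ t in σ..s₁, f t := intervalIntegral.integral_symm σ s₁
      have h2 : 0 ≤ ∫ t in σ..s₁, f t := intervalIntegral.integral_nonneg h fun t _ => hfnn t
      rw [h1]
      nlinarith [h2, hN, hκ]
  · -- slope `N` to the left of a point of `D`
    obtain ⟨r, hr, hball⟩ := Metric.isOpen_iff.1 hV d (hDV hd)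
    refine ⟨r / 2, half_pos hr, fun σ hσ => ?_⟩
    have hσd : σ ≤ d := hσ.2
    have hone : ∀ t ∈ uIcc σ d, f t = 1 := by
      intro t ht
      rw [uIcc_of_le hσd] at ht
      apply hf1
      apply subset_closure
      apply hball
      rw [Metric.mem_ball, Real.dist_eq, abs_lt]
      constructor <;> linarith [ht.1, ht.2, hσ.1]
    have h1 : (∫ t in s₁..d, f t) - ∫ t in s₁..σ, f t = ∫ t in σ..d, f t :=
      intervalIntegral.integral_interval_sub_left (hint _ _) (hint _ _)
    have h2 : ∫ t in σ..d, f t = ∫ _t in σ..d, (1 : ℝ) := intervalIntegral.integral_congr hone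
    rw [← mul_sub, h1, h2, intervalIntegral.integral_const, smul_eq_mul, mul_one]

end Summit.NavierStokesRegularity.NavierStokesRegularity.Theorems.PoloidalLiouville.NetFlux
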